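import Summits.MatrixMultiplication.OmegaCensus.SmallFormats.MatMul225GF3MarginalOrbit
import Summits.MatrixMultiplication.OmegaCensus.SmallFormats.MatMul22nRankGF3ThreeNPlusTwo
import Summits.MatrixMultiplication.OmegaCensus.SmallFormats.RestrictionFlatteningCaps
import Summits.MatrixMultiplication.OmegaCensus.SmallFormats.RankOnePlaneCapQuant
import Summits.MatrixMultiplication.OmegaCensus.SmallFormats.RankOnePlaneCapCol
import Summits.MatrixMultiplication.OmegaCensus.SmallFormats.RankOneXFormsSumBound
import HarnessLib

/-!
# ω-census family (a): the UNIVERSE of the `𝔽₃` `⟨2,2,5⟩@17` X-marginal census — the X-cap system as ONE kernel predicate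

Cell `pub-omega` (unit `pub-omega-tensor`, gen 30), topic `Summits/MatrixMultiplication/OmegaCensus`
(sub-folder `SmallFormats`). Framing (verbatim): lottery ticket; floor = certified bounds/negative
ranges. HONEST FRAMING: bookkeeping — every constraint the orbit enumerator of the census
(`margorbits2.py`, tensor g5; 62 018 orbits at `(n, r) = (5, 17)`) imposes on an X-marginal is a
landed cap theorem; this file ASSEMBLES them, in the language of the coefficient matrices
`U_i = xMarginal β i` (`MatMul225GF3MarginalOrbit`), into one predicate `XCaps3 n r m` and proves it
for the marginal of every `r`-product `𝔽₃`-computation of `⟨2,2,n⟩` (`xCaps3_xMarginal`):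

* point caps `#{i : U_i ∈ k·a} ≤ r − 3n` (`a ≠ 0`; via a dual-number plane inside `a^⊥`,
  `exists_perp3_of_ne_zero` by `decide`, and `JPlane.three_mul_add_card_le`);
* line caps `#{i : f_i(X₀) = 0} ≤ r − 2n` (`det X₀ ≠ 0`) / `≤ r − n` (`X₀ ≠ 0`)
  (`RestrictionFlatteningCaps`; these contain the split-plane caps);
* dual-number planes (32, `perp3`) and `𝔽₉`-planes (18, `perpQ3`): `≤ r − 3n`
  (`MatMul22nRankGF3LowerBound` / `MatMul22nRankGF3ThreeNPlusTwo`);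
* rank-one ROW planes `{λ zᵀ}` (`λᵀ U_i = 0`) and COLUMN planes `{z λᵀ}` (`U_i λ = 0`):
  `|R| + 6n ≤ 2r` (`RankOnePlaneCapQuant`) and, when `r < 4n`, `|R| + 2n + 1 ≤ r`
  (`RankOnePlaneCap` / `RankOnePlaneCapCol`);
* `∑_i rank U_i ≥ 4n` (`RankOneXFormsSumBound`).

Consequence (`eighteen_le_tensorRank_225_gf3_of_enumeration`): `18 ≤ R_𝔽₃(⟨2,2,5⟩)` follows from two
purely COMBINATORIAL engine facts — every nowhere-zero `m : Fin 17 → 𝔽₃^{2×2}` with `XCaps3 5 17 m`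
is `InOrbit`-related to one of the representatives, and no representative is the X-marginal of a
17-product computation. Neither is proved here; nothing in this file is a bound on `ω` or the
statement 'R_𝔽₃(⟨2,2,5⟩) = 18'.
-/

namespace Summit.MatrixMultiplication.OmegaCensus.RankOnePlaneCapGeneral

open Module Matrix Literature.Computability.AlgebraicComplexity
open Summit.MatrixMultiplication.OmegaCensus.SmallFormats
open scoped Classical

/-- A `2 × 2` matrix as a coefficient function on `Fin 2 × Fin 2` (the convention of `dotX`, `perp3`,
`perpQ3`, `rk3`). -/
def mflat {k : Type*} (M : Matrix (Fin 2) (Fin 2) k) : Fin 2 × Fin 2 → k := fun b => M b.1 b.2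

/-- Entries of `mflat`. -/
@[simp] theorem mflat_apply {k : Type*} (M : Matrix (Fin 2) (Fin 2) k) (b : Fin 2 × Fin 2) :
    mflat M b = M b.1 b.2 := rfl

variable {k : Type*} [Field k] {n : ℕ} {ι : Type*} [Fintype ι]

/-- The X-form of product `i` in the `dotX` convention: `f_i(X) = dotX (mflat U_i) X`. -/
theorem f_apply_eq_dotX (β : BilinComp (mulBilin k 2 2 n) ι) (i : ι) (X : Matrix (Fin 2) (Fin 2) k) :
    β.f i X = dotX (mflat (xMarginal β i)) X := by
  rw [f_apply_eq_sum_xMarginal, dotX, Fintype.sum_prod_type]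
  exact Finset.sum_congr rfl fun c _ => Finset.sum_congr rfl fun d _ => mul_comm _ _

/-- On a row-type rank-one matrix `λ zᵀ`: `f_i(λ zᵀ) = z · (λᵀ U_i)`. -/
theorem f_apply_vecMulVec_row (β : BilinComp (mulBilin k 2 2 n) ι) (i : ι) (lam z : Fin 2 → k) :
    β.f i (vecMulVec lam z) = z ⬝ᵥ Matrix.vecMul lam (xMarginal β i) := by
  rw [f_apply_eq_sum_xMarginal, dotProduct, Finset.sum_comm]
  refine Finset.sum_congr rfl fun d _ => ?_
  rw [Matrix.vecMul, dotProduct, Finset.mul_sum]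
  exact Finset.sum_congr rfl fun c _ => by rw [vecMulVec_apply]; ring

/-- On a column-type rank-one matrix `z λᵀ`: `f_i(z λᵀ) = z · (U_i λ)`. -/
theorem f_apply_vecMulVec_col (β : BilinComp (mulBilin k 2 2 n) ι) (i : ι) (z lam : Fin 2 → k) :
    β.f i (vecMulVec z lam) = z ⬝ᵥ Matrix.mulVec (xMarginal β i) lam := by
  rw [f_apply_eq_sum_xMarginal, dotProduct]
  refine Finset.sum_congr rfl fun c _ => ?_
  rw [Matrix.mulVec, dotProduct, Finset.mul_sum]
  exact Finset.sum_congr rfl fun d _ => by rw [vecMulVec_apply]; ring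

/-! ## The caps, one family at a time (any `r`-product computation of `⟨2,2,n⟩`) -/

section AnyField

/-- **Line cap, invertible point**: the products whose X-form kills an invertible `X₀` number
`≤ r − 2n`. -/
theorem lineCap_of_det_ne_zero (β : BilinComp (mulBilin k 2 2 n) ι) (X₀ : Matrix (Fin 2) (Fin 2) k)
    (hX : X₀.det ≠ 0) :
    2 * n + (Finset.univ.filter fun i => dotX (mflat (xMarginal β i)) X₀ = 0).card ≤ Fintype.card ι :=
  two_mul_add_card_perp_le_of_isUnit β (fun i => mflat (xMarginal β i)) (f_apply_eq_dotX β) X₀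
    (isUnit_iff_ne_zero.mpr hX) _ fun _ h => h

/-- **Line cap, nonzero point**: the products whose X-form kills a nonzero `X₀` number `≤ r − n`. -/
theorem lineCap_of_ne_zero (β : BilinComp (mulBilin k 2 2 n) ι) (X₀ : Matrix (Fin 2) (Fin 2) k)
    (hX : X₀ ≠ 0) :
    n + (Finset.univ.filter fun i => dotX (mflat (xMarginal β i)) X₀ = 0).card ≤ Fintype.card ι :=
  add_card_perp_le_of_ne_zero β (fun i => mflat (xMarginal β i)) (f_apply_eq_dotX β) X₀ hX _
    fun _ h => h

/-- **Row rank-one plane, quantitative cap** (`λ ≠ 0`): the products with `λᵀ U_i = 0` (X-form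
vanishing on `{λ zᵀ}`) satisfy `|R| + 6n ≤ 2r`. -/
theorem rowPlaneCap_quant (β : BilinComp (mulBilin k 2 2 n) ι) {lam : Fin 2 → k} (hlam : lam ≠ 0) :
    (Finset.univ.filter fun i => Matrix.vecMul lam (xMarginal β i) = 0).card + 6 * n ≤
      2 * Fintype.card ι :=
  card_vanishing_le_two_mul_sub le_rfl β hlam _ fun i hi z => by
    rw [Finset.mem_filter] at hi
    rw [f_apply_vecMulVec_row, hi.2, dotProduct_zero]

/-- **Row rank-one plane, near cap** (`λ ≠ 0`, `r < 4n`): `|R| + 2n + 1 ≤ r`. -/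
theorem rowPlaneCap_near (β : BilinComp (mulBilin k 2 2 n) ι) (h4 : Fintype.card ι < 4 * n)
    {lam : Fin 2 → k} (hlam : lam ≠ 0) :
    (Finset.univ.filter fun i => Matrix.vecMul lam (xMarginal β i) = 0).card + 2 * n + 1 ≤
      Fintype.card ι := by
  have h := card_vanishing_add_lt le_rfl (by omega) β hlam
    (Finset.univ.filter fun i => Matrix.vecMul lam (xMarginal β i) = 0) fun i hi z => by
      rw [Finset.mem_filter] at hi
      rw [f_apply_vecMulVec_row, hi.2, dotProduct_zero]
  omega

/-- **Column rank-one plane, quantitative cap** (`λ ≠ 0`): the products with `U_i λ = 0` (X-form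
vanishing on `{z λᵀ}`) satisfy `|R| + 6n ≤ 2r`. -/
theorem colPlaneCap_quant (β : BilinComp (mulBilin k 2 2 n) ι) {lam : Fin 2 → k} (hlam : lam ≠ 0) :
    (Finset.univ.filter fun i => Matrix.mulVec (xMarginal β i) lam = 0).card + 6 * n ≤
      2 * Fintype.card ι := by
  have h := card_vanishing_col_quant le_rfl β hlam
    (Finset.univ.filter fun i => Matrix.mulVec (xMarginal β i) lam = 0) fun i hi z => by
      rw [Finset.mem_filter] at hi
      rw [f_apply_vecMulVec_col, hi.2, dotProduct_zero]
  omega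

/-- **Column rank-one plane, near cap** (`λ ≠ 0`, `r < 4n`): `|R| + 2n + 1 ≤ r`. -/
theorem colPlaneCap_near (β : BilinComp (mulBilin k 2 2 n) ι) (h4 : Fintype.card ι < 4 * n)
    {lam : Fin 2 → k} (hlam : lam ≠ 0) :
    (Finset.univ.filter fun i => Matrix.mulVec (xMarginal β i) lam = 0).card + 2 * n + 1 ≤
      Fintype.card ι := by
  have h := card_vanishing_col_add_lt le_rfl (by omega) β hlam
    (Finset.univ.filter fun i => Matrix.mulVec (xMarginal β i) lam = 0) fun i hi z => by
      rw [Finset.mem_filter] at hi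
      rw [f_apply_vecMulVec_col, hi.2, dotProduct_zero]
  omega

end AnyField

/-! ## The `𝔽₃`-specific families (tables of `MatMul22nRankGF3LowerBound` / `…ThreeNPlusTwo`) -/

section GF3

variable {ι : Type*} [Fintype ι]

/-- **Dual-number planes**: for each of the 32 planes, the products whose coefficient matrix
annihilates it number `≤ r − 3n`. -/
theorem jPlaneCap (β : BilinComp (mulBilin (ZMod 3) 2 2 n) ι) (l : Fin 32) :
    3 * n + (Finset.univ.filter fun i => perp3 (mflat (xMarginal β i)) l = true).card ≤
      Fintype.card ι :=
  (jPlane3 l).three_mul_add_card_le β (fun i => mflat (xMarginal β i)) (f_apply_eq_dotX β) _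
    fun _ h => perp3_dotX h

/-- **`𝔽₉`-planes**: for each of the 18 planes, the products whose coefficient matrix annihilates it
number `≤ r − 3n`. -/
theorem qPlaneCap (β : BilinComp (mulBilin (ZMod 3) 2 2 n) ι) (l : Fin 18) :
    3 * n + (Finset.univ.filter fun i => perpQ3 (mflat (xMarginal β i)) l = true).card ≤
      Fintype.card ι :=
  (qPlane3 l).three_mul_add_card_le zmod3_sq_ne β (fun i => mflat (xMarginal β i))
    (f_apply_eq_dotX β) _ fun _ h => perpQ3_dotX h

/-- Every nonzero `a ∈ M₂(𝔽₃)` is annihilated by (both generators of) one of the 32 dual-number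
planes — i.e. the hyperplane `a^⊥` contains a dual-number plane (`decide` over the 80 matrices). -/
theorem exists_perp3_of_ne_zero : ∀ a b c d : ZMod 3, ¬ (a = 0 ∧ b = 0 ∧ c = 0 ∧ d = 0) →
    ∃ l : Fin 32, perp3 (mk4 a b c d) l = true := by
  decide

/-- `mflat` of a matrix is `mk4` of its entries. -/
theorem mflat_eq_mk4 {k : Type*} (M : Matrix (Fin 2) (Fin 2) k) :
    mflat M = mk4 (M 0 0) (M 0 1) (M 1 0) (M 1 1) := by
  funext ⟨i, j⟩
  fin_cases i <;> fin_cases j <;> rfl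

/-- `perp3` is homogeneous: a multiple of an annihilator annihilates. -/
theorem perp3_smul {a : Matrix (Fin 2) (Fin 2) (ZMod 3)} {l : Fin 32} (h : perp3 (mflat a) l = true)
    (c : ZMod 3) : perp3 (mflat (c • a)) l = true := by
  have h' := of_decide_eq_true h
  rw [perp3, decide_eq_true_eq]
  simp only [pdot3, mflat_apply, Matrix.smul_apply, smul_eq_mul] at h' ⊢
  constructor
  · linear_combination c * h'.1
  · linear_combination c * h'.2

/-- **Point caps**: for every nonzero `a`, the products whose coefficient matrix is a multiple of `a`
number `≤ r − 3n` (through the dual-number plane inside `a^⊥`). -/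
theorem pointCap (β : BilinComp (mulBilin (ZMod 3) 2 2 n) ι) (a : Matrix (Fin 2) (Fin 2) (ZMod 3))
    (ha : a ≠ 0) :
    3 * n + (Finset.univ.filter fun i => ∃ c : ZMod 3, xMarginal β i = c • a).card ≤
      Fintype.card ι := by
  have hne : ¬ (a 0 0 = 0 ∧ a 0 1 = 0 ∧ a 1 0 = 0 ∧ a 1 1 = 0) := by
    rintro ⟨h1, h2, h3, h4⟩
    apply ha
    ext i j
    fin_cases i <;> fin_cases j <;> assumption
  obtain ⟨l, hl⟩ := exists_perp3_of_ne_zero _ _ _ _ hne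
  rw [← mflat_eq_mk4] at hl
  refine le_trans (Nat.add_le_add_left (Finset.card_le_card ?_) _) (jPlaneCap β l)
  intro i hi
  rw [Finset.mem_filter] at hi ⊢
  obtain ⟨c, hc⟩ := hi.2
  exact ⟨hi.1, by rw [hc]; exact perp3_smul hl c⟩

/-- **Rank sum** `∑_i rank U_i ≥ 4n` (with `rk3 ∈ {0,1,2}`): the computation is a triad decomposition
of `⟨2,2,n⟩` whose X-components are the `U_i`, and each `U_i` is a sum of `rk3 U_i` products. -/
theorem four_mul_le_sum_rk3 {ι : Type} [Fintype ι] (β : BilinComp (mulBilin (ZMod 3) 2 2 n) ι) :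
    4 * n ≤ ∑ i, rk3 (mflat (xMarginal β i)) := by
  classical
  -- the computation as a triad decomposition (as in `RankRowIncrement.tensorRank_le_card`)
  have hdec : matMulTensor (ZMod 3) 2 2 n = ∑ i, triad (fun a : Fin 2 × Fin n => β.w i a.1 a.2)
      (mflat (xMarginal β i)) (fun q : Fin 2 × Fin n => β.g i (Matrix.single q.1 q.2 1)) := by
    funext a b q
    have h := β.map_eq_sum (Matrix.single b.1 b.2 (1 : ZMod 3)) (Matrix.single q.1 q.2 (1 : ZMod 3))
    rw [mulBilin_apply] at h
    have h' := congrFun (congrFun h a.1) a.2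
    rw [Matrix.sum_apply] at h'
    simp only [Matrix.smul_apply, smul_eq_mul] at h'
    have lhs : (Matrix.single b.1 b.2 (1 : ZMod 3) * Matrix.single q.1 q.2 (1 : ZMod 3)) a.1 a.2 =
        matMulTensor (ZMod 3) 2 2 n a b q := by
      simp only [matMulTensor]
      by_cases hbq : b.2 = q.1
      · rw [hbq, Matrix.single_mul_single_same, mul_one, Matrix.single_apply]
        by_cases h1 : a.1 = b.1 <;> by_cases h2 : a.2 = q.2 <;> simp [h1, h2, eq_comm]
      · rw [Matrix.single_mul_single_of_ne (h := hbq), Matrix.zero_apply]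
        simp [hbq]
    rw [← lhs, h', Finset.sum_apply, Finset.sum_apply, Finset.sum_apply]
    refine Finset.sum_congr rfl fun i _ => ?_
    rw [triad_apply, mflat_apply, xMarginal_apply]
    ring
  choose ρ rr cc hρ hfac using fun i => exists_fac3 (mflat (xMarginal β i))
  have hS := RankOneXForms.four_mul_le_sum_rankBound_X_22n n _ _ _ hdec ρ rr cc
    (fun i κ μ => hfac i κ μ)
  calc 4 * n ≤ ∑ i, ρ i := hS
    _ = ∑ i, rk3 (mflat (xMarginal β i)) := Finset.sum_congr rfl fun i _ => hρ i

end GF3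

/-! ## The universe predicate and the census reduction in enumeration form -/

/-- **The X-cap system of the `𝔽₃` `⟨2,2,n⟩@r` marginal census** (the constraints of the enumerator
`margorbits2.py`, in the language of coefficient matrices): point caps, line caps (invertible /
nonzero point — the split-plane caps are among these), dual-number and `𝔽₉` plane caps, row and
column rank-one plane caps (quantitative and near), and the rank sum. -/
def XCaps3 (n r : ℕ) (m : Fin r → Matrix (Fin 2) (Fin 2) (ZMod 3)) : Prop :=
  (∀ a : Matrix (Fin 2) (Fin 2) (ZMod 3), a ≠ 0 →
      3 * n + (Finset.univ.filter fun i => ∃ c : ZMod 3, m i = c • a).card ≤ r) ∧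
  (∀ X₀ : Matrix (Fin 2) (Fin 2) (ZMod 3), X₀.det ≠ 0 →
      2 * n + (Finset.univ.filter fun i => dotX (mflat (m i)) X₀ = 0).card ≤ r) ∧
  (∀ X₀ : Matrix (Fin 2) (Fin 2) (ZMod 3), X₀ ≠ 0 →
      n + (Finset.univ.filter fun i => dotX (mflat (m i)) X₀ = 0).card ≤ r) ∧
  (∀ l : Fin 32, 3 * n + (Finset.univ.filter fun i => perp3 (mflat (m i)) l = true).card ≤ r) ∧
  (∀ l : Fin 18, 3 * n + (Finset.univ.filter fun i => perpQ3 (mflat (m i)) l = true).card ≤ r) ∧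
  (∀ lam : Fin 2 → ZMod 3, lam ≠ 0 →
      (Finset.univ.filter fun i => Matrix.vecMul lam (m i) = 0).card + 6 * n ≤ 2 * r ∧
      (r < 4 * n → (Finset.univ.filter fun i => Matrix.vecMul lam (m i) = 0).card + 2 * n + 1 ≤ r)) ∧
  (∀ lam : Fin 2 → ZMod 3, lam ≠ 0 →
      (Finset.univ.filter fun i => Matrix.mulVec (m i) lam = 0).card + 6 * n ≤ 2 * r ∧
      (r < 4 * n → (Finset.univ.filter fun i => Matrix.mulVec (m i) lam = 0).card + 2 * n + 1 ≤ r)) ∧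
  4 * n ≤ ∑ i, rk3 (mflat (m i))

/-- **Every computation lives in the universe**: the X-marginal of an `r`-product `𝔽₃`-computation
of `⟨2,2,n⟩` satisfies the whole X-cap system. -/
theorem xCaps3_xMarginal {r : ℕ} (β : BilinComp (mulBilin (ZMod 3) 2 2 n) (Fin r)) :
    XCaps3 n r (xMarginal β) := by
  have hr : Fintype.card (Fin r) = r := Fintype.card_fin r
  refine ⟨fun a ha => ?_, fun X₀ hX => ?_, fun X₀ hX => ?_, fun l => ?_, fun l => ?_,
    fun lam hlam => ⟨?_, fun h4 => ?_⟩, fun lam hlam => ⟨?_, fun h4 => ?_⟩, four_mul_le_sum_rk3 β⟩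
  · have h := pointCap β a ha; rw [hr] at h; convert h
  · have h := lineCap_of_det_ne_zero β X₀ hX; rw [hr] at h; convert h
  · have h := lineCap_of_ne_zero β X₀ hX; rw [hr] at h; convert h
  · have h := jPlaneCap β l; rw [hr] at h; convert h
  · have h := qPlaneCap β l; rw [hr] at h; convert h
  · have h := rowPlaneCap_quant β hlam; rw [hr] at h; convert h
  · have h := rowPlaneCap_near β (by rw [hr]; exact h4) hlam; rw [hr] at h; convert h
  · have h := colPlaneCap_quant β hlam; rw [hr] at h; convert h
  · have h := colPlaneCap_near β (by rw [hr]; exact h4) hlam; rw [hr] at h; convert h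

/-- **Census reduction, enumeration form.** `18 ≤ R_𝔽₃(⟨2,2,5⟩)` (hence `= 18` with the Hopcroft–Kerr
ceiling) follows from two COMBINATORIAL statements about a set `Reps` of representatives:
(i) ENUMERATION COMPLETE — every nowhere-zero `m : Fin 17 → 𝔽₃^{2×2}` satisfying the X-cap system
`XCaps3 5 17` is `InOrbit`-related to a member of `Reps` (engine-side: the 62 018 orbit
representatives of the census); (ii) EVERY REPRESENTATIVE EXCLUDED — no member of `Reps` is the
X-marginal of a 17-product computation (engine-side: kernel IP rules / ω-engine / completion /
gauge-SAT, orbit by orbit). Neither (i) nor (ii) is proved here. -/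
theorem eighteen_le_tensorRank_225_gf3_of_enumeration
    (Reps : Set (Fin 17 → Matrix (Fin 2) (Fin 2) (ZMod 3)))
    (henum : ∀ m : Fin 17 → Matrix (Fin 2) (Fin 2) (ZMod 3), (∀ i, m i ≠ 0) → XCaps3 5 17 m →
      ∃ rep ∈ Reps, InOrbit m rep)
    (hexcl : ∀ rep ∈ Reps, ∀ β : BilinComp (mulBilin (ZMod 3) 2 2 5) (Fin 17), xMarginal β ≠ rep) :
    18 ≤ tensorRank (matMulTensor (ZMod 3) 2 2 5) :=
  eighteen_le_tensorRank_225_gf3_of_caps_census (XCaps3 5 17) xCaps3_xMarginal Reps henum hexcl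

end Summit.MatrixMultiplication.OmegaCensus.RankOnePlaneCapGeneral
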